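import Mathlib

/-!
# Route `FilamentSkeletonRss` · crux `TransverseReduction1AG` (stmt-NavierStokesRegularity-27853) · line `defect_column_gate_1AG` —
# LOG-SCALE CUT-OFFS: the test functions that commute with dilations up to `1/L`

Helper file (`--supports stmt-NavierStokesRegularity-27853 --as helper`; LEAD of 27853, lane ns-filament-21221-p1 g10).  One-variable toolkit for
quasimode / test-function arguments against the DILATION-TYPE transport terms of the line's operators (`b·x∂ₓ` in the section, `κτ∂_τ` along the
axis): a bump on the LOGARITHMIC scale, `x ↦ χ₀(log x / L)`, has `x∂ₓ` of size `1/L`, and the profiles `ψ(log x/L)·x^{-n}` are mapped by `d/dx` to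
profiles of the same shape one power down (`eulerStep`).  Used by: the owed construction `FarFieldQuasimodes1A` (`Theorems/…WaistQuasimodes.lean`,
memo S2A-FALSE-FARFIELD-27853-g10.md §6: `F_D = χ₀(log x₁/log D)·x₁^{-4}`), and the kill-first test of S2a-loc by axial log-modulations (tenure g20 V1).
HONEST FRAMING: elementary real analysis; MODEL rung, negative side; nothing here bears on Navier–Stokes regularity.

* `bump12 = expNegInvGlue(t−1)·expNegInvGlue(2−t)`: smooth, `≥ 0`, `= 0` off `(1,2)`, `> 0` on `(1,2)`; all iterated derivatives vanish on `t < 1`,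
  are continuous, compactly supported and bounded (`exists_bound_iteratedDeriv_bump12`);
* `hasDerivAt_logScale` — for `x ≠ 0`, `L ≠ 0`: `d/dx [ψ(log x/L)·(xⁿ)⁻¹] = (ψ′(log x/L)/L − n·ψ(log x/L))·(xⁿ⁺¹)⁻¹` (=: `eulerStep`);
* `logScale_eventuallyEq_zero` / `hasDerivAt_logScale_of_abs_lt_one` — if `ψ` vanishes on `t < 1` and `0 < L`, the profile vanishes on `|x| < 1`, so the
  same formula holds at every `x` (both sides are `0` at `x = 0`); `contDiff_logScale` — the profile is `C^∞` on `ℝ`;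
* `abs_pow_mul_logScale_le` — `|x|ⁿ·|ψ(log x/L)(xⁿ)⁻¹| ≤ sup|ψ|`: the profiles are weight-neutral for the weight `|x|ⁿ`;
* `eulerStep` bookkeeping: vanishing below `1` and smoothness are preserved; `abs_eulerStep_le` (`|L| ≥ 1`).
-/

set_option linter.dupNamespace false

noncomputable section

namespace Summit.NavierStokesRegularity.NavierStokesRegularity.Theorems.DefectColumnGate

open scoped Topology ContDiff
open Set Function Filter

/-! ## 1. The bump `χ₀` on `(1, 2)` -/

/-- The standard smooth bump supported in `[1, 2]`: `χ₀(t) = expNegInvGlue(t − 1)·expNegInvGlue(2 − t)`. -/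
def bump12 (t : ℝ) : ℝ := expNegInvGlue (t - 1) * expNegInvGlue (2 - t)

/-- `χ₀ ≥ 0`. -/
theorem bump12_nonneg (t : ℝ) : 0 ≤ bump12 t := mul_nonneg (expNegInvGlue.nonneg _) (expNegInvGlue.nonneg _)

/-- `χ₀(t) = 0` for `t ≤ 1`. -/
theorem bump12_eq_zero_of_le_one {t : ℝ} (ht : t ≤ 1) : bump12 t = 0 := by
  rw [bump12, expNegInvGlue.zero_of_nonpos (by linarith), zero_mul]

/-- `χ₀(t) = 0` for `2 ≤ t`. -/
theorem bump12_eq_zero_of_two_le {t : ℝ} (ht : 2 ≤ t) : bump12 t = 0 := by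
  rw [bump12, expNegInvGlue.zero_of_nonpos (x := 2 - t) (by linarith), mul_zero]

/-- `χ₀(t) > 0` for `1 < t < 2`. -/
theorem bump12_pos {t : ℝ} (h1 : 1 < t) (h2 : t < 2) : 0 < bump12 t :=
  mul_pos (expNegInvGlue.pos_of_pos (by linarith)) (expNegInvGlue.pos_of_pos (by linarith))

/-- `χ₀ ∈ C^∞`. -/
theorem contDiff_bump12 {n : ℕ∞} : ContDiff ℝ n bump12 :=
  (expNegInvGlue.contDiff.comp (contDiff_id.sub contDiff_const)).mul (expNegInvGlue.contDiff.comp (contDiff_const.sub contDiff_id))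

/-- `χ₀` vanishes identically near every `t < 1`. -/
theorem bump12_eventuallyEq_zero {t : ℝ} (ht : t < 1) : bump12 =ᶠ[𝓝 t] fun _ => 0 :=
  (eventually_lt_nhds ht).mono fun _ hs => bump12_eq_zero_of_le_one hs.le

/-- `χ₀` vanishes identically near every `t > 2`. -/
theorem bump12_eventuallyEq_zero' {t : ℝ} (ht : 2 < t) : bump12 =ᶠ[𝓝 t] fun _ => 0 :=
  (eventually_gt_nhds ht).mono fun _ hs => bump12_eq_zero_of_two_le hs.le

/-- All iterated derivatives of `χ₀` vanish on `t < 1`. -/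
theorem iteratedDeriv_bump12_eq_zero_of_lt_one (k : ℕ) {t : ℝ} (ht : t < 1) : iteratedDeriv k bump12 t = 0 := by
  have h : iteratedDeriv k bump12 =ᶠ[𝓝 t] fun _ => (0:ℝ) := by
    induction k with
    | zero => simpa only [iteratedDeriv_zero] using bump12_eventuallyEq_zero ht
    | succ k ih =>
      rw [iteratedDeriv_succ]
      have h2 : ∀ᶠ s in 𝓝 t, iteratedDeriv k bump12 =ᶠ[𝓝 s] fun _ => (0:ℝ) := ih.eventually_nhds
      exact h2.mono fun s hs => by rw [hs.deriv_eq, deriv_const]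
  exact h.self_of_nhds

/-- All iterated derivatives of `χ₀` vanish on `t > 2`. -/
theorem iteratedDeriv_bump12_eq_zero_of_two_lt (k : ℕ) {t : ℝ} (ht : 2 < t) : iteratedDeriv k bump12 t = 0 := by
  have h : iteratedDeriv k bump12 =ᶠ[𝓝 t] fun _ => (0:ℝ) := by
    induction k with
    | zero => simpa only [iteratedDeriv_zero] using bump12_eventuallyEq_zero' ht
    | succ k ih =>
      rw [iteratedDeriv_succ]
      have h2 : ∀ᶠ s in 𝓝 t, iteratedDeriv k bump12 =ᶠ[𝓝 s] fun _ => (0:ℝ) := ih.eventually_nhds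
      exact h2.mono fun s hs => by rw [hs.deriv_eq, deriv_const]
  exact h.self_of_nhds

/-- The iterated derivatives of `χ₀` are continuous … -/
theorem continuous_iteratedDeriv_bump12 (k : ℕ) : Continuous (iteratedDeriv k bump12) :=
  contDiff_bump12.continuous_iteratedDeriv k (by exact_mod_cast le_top)

/-- … compactly supported (in `[1, 2]`) … -/
theorem hasCompactSupport_iteratedDeriv_bump12 (k : ℕ) : HasCompactSupport (iteratedDeriv k bump12) := by
  refine HasCompactSupport.of_support_subset_isCompact (isCompact_Icc (a := (1:ℝ)) (b := 2)) ?_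
  intro t ht
  rw [Function.mem_support] at ht
  by_contra hc
  rw [mem_Icc, not_and_or, not_le, not_le] at hc
  rcases hc with h | h
  · exact ht (iteratedDeriv_bump12_eq_zero_of_lt_one k h)
  · exact ht (iteratedDeriv_bump12_eq_zero_of_two_lt k h)

/-- … hence BOUNDED: `∃ M, ∀ t, |χ₀⁽ᵏ⁾(t)| ≤ M`. -/
theorem exists_bound_iteratedDeriv_bump12 (k : ℕ) : ∃ M : ℝ, ∀ t, |iteratedDeriv k bump12 t| ≤ M := by
  obtain ⟨M, hM⟩ := (continuous_iteratedDeriv_bump12 k).bounded_above_of_compact_support (hasCompactSupport_iteratedDeriv_bump12 k)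
  exact ⟨M, fun t => by simpa [Real.norm_eq_abs] using hM t⟩

/-! ## 2. Log-scale profiles `ψ(log x / L)·x⁻ⁿ` and the Euler step -/

/-- The Euler step: `d/dx [ψ(log x/L)·x⁻ⁿ] = (eulerStep L n ψ)(log x/L)·x⁻⁽ⁿ⁺¹⁾` with `eulerStep L n ψ = ψ′/L − n·ψ`. -/
def eulerStep (L : ℝ) (n : ℕ) (ψ : ℝ → ℝ) (t : ℝ) : ℝ := deriv ψ t / L - n * ψ t

/-- **Derivative of a log-scale profile away from the origin.** -/
theorem hasDerivAt_logScale {ψ : ℝ → ℝ} {L x : ℝ} (hL : L ≠ 0) (hx : x ≠ 0) (n : ℕ) (hψ : DifferentiableAt ℝ ψ (Real.log x / L)) :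
    HasDerivAt (fun x => ψ (Real.log x / L) * (x ^ n)⁻¹) (eulerStep L n ψ (Real.log x / L) * (x ^ (n + 1))⁻¹) x := by
  have hlog : HasDerivAt (fun x => Real.log x / L) (x⁻¹ / L) x := (Real.hasDerivAt_log hx).div_const L
  have h1 : HasDerivAt (fun x => ψ (Real.log x / L)) (deriv ψ (Real.log x / L) * (x⁻¹ / L)) x :=
    hψ.hasDerivAt.comp x hlog
  have h2 : HasDerivAt (fun x : ℝ => (x ^ n)⁻¹) (-(↑n * x ^ (n - 1)) / (x ^ n) ^ 2) x :=
    (hasDerivAt_pow n x).inv (pow_ne_zero n hx)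
  refine (h1.mul h2).congr_deriv ?_
  rw [eulerStep]
  rcases Nat.eq_zero_or_pos n with rfl | hn
  · simp; field_simp
  · obtain ⟨m, rfl⟩ := Nat.exists_eq_add_of_le hn
    simp only [Nat.add_sub_cancel_left, pow_succ, Nat.cast_add, Nat.cast_one]
    field_simp
    ring

/-- A log-scale profile whose shape vanishes on `t < 1` VANISHES ON `|x| < 1` (`0 < L`; `Real.log 0 = 0`). -/
theorem logScale_eq_zero_of_abs_lt_one {ψ : ℝ → ℝ} (hψ : ∀ t, t < 1 → ψ t = 0) {L : ℝ} (hL : 0 < L) (n : ℕ) {x : ℝ} (hx : |x| < 1) :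
    ψ (Real.log x / L) * (x ^ n)⁻¹ = 0 := by
  have hlog : Real.log x ≤ 0 := by
    rcases eq_or_ne x 0 with rfl | hx0
    · simp
    · rw [← Real.log_abs]; exact Real.log_nonpos (abs_nonneg _) hx.le
  rw [hψ _ (by exact lt_of_le_of_lt (div_nonpos_of_nonpos_of_nonneg hlog hL.le) one_pos), zero_mul]

/-- … so it vanishes identically near every point of `|x| < 1`. -/
theorem logScale_eventuallyEq_zero {ψ : ℝ → ℝ} (hψ : ∀ t, t < 1 → ψ t = 0) {L : ℝ} (hL : 0 < L) (n : ℕ) {x : ℝ} (hx : |x| < 1) :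
    (fun x => ψ (Real.log x / L) * (x ^ n)⁻¹) =ᶠ[𝓝 x] fun _ => 0 := by
  have ho : IsOpen {x : ℝ | |x| < 1} := isOpen_lt continuous_abs continuous_const
  exact Filter.eventually_of_mem (ho.mem_nhds hx) fun z hz => logScale_eq_zero_of_abs_lt_one hψ hL n hz

/-- **Derivative of a log-scale profile at EVERY point** when the shape vanishes below `1` (`0 < L`): the Euler-step formula holds also at
`x = 0`, where both sides vanish. -/
theorem hasDerivAt_logScale' {ψ : ℝ → ℝ} (hψd : Differentiable ℝ ψ) (hψ0 : ∀ t, t < 1 → ψ t = 0) {L : ℝ} (hL : 0 < L) (n : ℕ)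
    (x : ℝ) :
    HasDerivAt (fun x => ψ (Real.log x / L) * (x ^ n)⁻¹) (eulerStep L n ψ (Real.log x / L) * (x ^ (n + 1))⁻¹) x := by
  rcases eq_or_ne x 0 with rfl | hx
  · have h0 : eulerStep L n ψ (Real.log 0 / L) * ((0:ℝ) ^ (n + 1))⁻¹ = 0 := by simp
    rw [h0]
    exact (hasDerivAt_const (0:ℝ) (0:ℝ)).congr_of_eventuallyEq (logScale_eventuallyEq_zero hψ0 hL n (by simp))
  · exact hasDerivAt_logScale hL.ne' hx n (hψd _)

/-- The Euler step preserves vanishing below `1` … -/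
theorem eulerStep_eq_zero_of_lt_one {ψ : ℝ → ℝ} (hψ0 : ∀ t, t < 1 → ψ t = 0) (L : ℝ) (n : ℕ) {t : ℝ} (ht : t < 1) :
    eulerStep L n ψ t = 0 := by
  have h : ψ =ᶠ[𝓝 t] fun _ => (0:ℝ) := (eventually_lt_nhds ht).mono fun s hs => hψ0 s hs
  rw [eulerStep, h.deriv_eq, deriv_const, hψ0 t ht]; simp

/-- … and smoothness. -/
theorem contDiff_eulerStep {ψ : ℝ → ℝ} {n : ℕ∞} (hψ : ContDiff ℝ (n + 1) ψ) (L : ℝ) (m : ℕ) : ContDiff ℝ n (eulerStep L m ψ) := by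
  have h1 : ContDiff ℝ n (deriv ψ) := hψ.deriv'
  have h0 : ContDiff ℝ n ψ := hψ.of_le (by exact_mod_cast le_self_add)
  exact (h1.div_const L).sub (contDiff_const.mul h0)

/-- **Smoothness of log-scale profiles on all of `ℝ`** (shape smooth and vanishing below `1`, `0 < L`). -/
theorem contDiff_logScale {ψ : ℝ → ℝ} {m : ℕ∞} (hψ : ContDiff ℝ m ψ) (hψ0 : ∀ t, t < 1 → ψ t = 0) {L : ℝ} (hL : 0 < L) (n : ℕ) :
    ContDiff ℝ m (fun x => ψ (Real.log x / L) * (x ^ n)⁻¹) := by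
  refine contDiff_iff_contDiffAt.2 fun x => ?_
  by_cases hx : |x| < 1
  · exact contDiffAt_const.congr_of_eventuallyEq (logScale_eventuallyEq_zero hψ0 hL n hx)
  · have hx0 : x ≠ 0 := by
      intro h; apply hx; rw [h, abs_zero]; exact one_pos
    have hlog : ContDiffAt ℝ m (fun x => Real.log x / L) x := (Real.contDiffAt_log.2 hx0).div_const L
    exact (hψ.contDiffAt.comp x hlog).mul ((contDiffAt_id.pow n).inv (pow_ne_zero n hx0))

/-- **Weight neutrality**: `|x|ⁿ·|ψ(log x/L)·x⁻ⁿ| ≤ sup |ψ|`. -/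
theorem abs_pow_mul_logScale_le {ψ : ℝ → ℝ} {M : ℝ} (hM : ∀ t, |ψ t| ≤ M) (L : ℝ) (n : ℕ) (x : ℝ) :
    |x| ^ n * |ψ (Real.log x / L) * (x ^ n)⁻¹| ≤ M := by
  have hM0 : 0 ≤ M := le_trans (abs_nonneg _) (hM 0)
  rcases eq_or_ne x 0 with rfl | hx
  · rcases Nat.eq_zero_or_pos n with rfl | hn
    · simpa using hM _
    · simp [zero_pow hn.ne', hM0]
  · rw [abs_mul, abs_inv, abs_pow, ← mul_assoc, mul_comm (|x| ^ n), mul_assoc,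
      mul_inv_cancel₀ (pow_ne_zero n (abs_ne_zero.2 hx)), mul_one]
    exact hM _

/-- Size of the Euler step: `|ψ′| ≤ A′`, `|ψ| ≤ A`, `1 ≤ |L|` ⇒ `|eulerStep L n ψ| ≤ A′ + n·A` (UNIFORM in `L`: this is where the `1/L` of the
log scale pays). -/
theorem abs_eulerStep_le {ψ : ℝ → ℝ} {A A' L : ℝ} (hA : ∀ t, |ψ t| ≤ A) (hA' : ∀ t, |deriv ψ t| ≤ A') (hL : 1 ≤ |L|) (n : ℕ) (t : ℝ) :
    |eulerStep L n ψ t| ≤ A' + n * A := by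
  rw [eulerStep]
  have h1 : |deriv ψ t / L| ≤ A' := by
    rw [abs_div]
    exact le_trans (div_le_self (abs_nonneg _) hL) (hA' t)
  have h2 : |(n:ℝ) * ψ t| ≤ n * A := by
    rw [abs_mul, Nat.abs_cast]; exact mul_le_mul_of_nonneg_left (hA t) n.cast_nonneg
  exact le_trans (abs_sub _ _) (add_le_add h1 h2)

/-- The commutator with the dilation: `x·d/dx` of the pure cut-off `χ(log x/L)` is `χ′(log x/L)/L` — of size `sup|χ′|/L`. -/
theorem hasDerivAt_logCutoff {χ : ℝ → ℝ} {L x : ℝ} (hL : L ≠ 0) (hx : x ≠ 0) (hχ : DifferentiableAt ℝ χ (Real.log x / L)) :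
    HasDerivAt (fun x => χ (Real.log x / L)) (deriv χ (Real.log x / L) / L * x⁻¹) x := by
  have h := hasDerivAt_logScale hL hx 0 hχ
  simp only [pow_zero, inv_one, mul_one, eulerStep, Nat.cast_zero, zero_mul, sub_zero, zero_add, pow_one] at h
  exact h

end Summit.NavierStokesRegularity.NavierStokesRegularity.Theorems.DefectColumnGate

end
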